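import Summits.QuantumFields.YangMills.Theorems.BalabanUVNodesN15KingModelAnalyticDeterminantTraceTools
import Summits.QuantumFields.YangMills.Theorems.BalabanUVNodesN15KingModelCovariantKatoDomination
import Literature.LinearAlgebra.Matrix.ChordalMaximumDeterminantCompletion
import HarnessLib

/-!
# BalabanUVNodes ∕ N15 — THE KING-MODEL RUNG (PART Ϯ-b): THE VOLUME LAW FOR THE FINE GAUSSIAN NORMALISATION — LOCALITY OF `ln det(−cΔ_U + m²)` IN THE BACKGROUND:
# `|ln det M_U − ln det M_V| ≤ 2c·G(0,0)·Σ_bΣ_{ij}|U(b)_{ij} − V(b)_{ij}|` at EVERY pair of unitary link fields (`G(0,0) = (lapF)⁻¹(0,0)` = KING's `A = 0` covariance at coinciding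
# points), hence `≤ 4c·|n|²·G(0,0)·#Z` when `U = V` off the bond set `Z` — the response sandwich at both ends, the trace against a bond-supported perturbation, and KATO
# (Track A, DAG node N15 = NE2; FAN-OUT v1.1 §N15 s3 «KING-MODEL RUNG … + what the curved case adds»; count-neutral)

HONEST FRAMING.  Count-neutral (cell `pub-ymgap`, seat `pub-ymgap-dag-n15-e` g54; `--supports stmt-QuantumFields-27247 --as helper` = K3ᴬ, KEY MAP v3).  One finite torus `Π_μℤ∕K_μ`
at fixed spacing; King's one-level comparison model; the FINE covariant normalisation `det M_U`, `M_U = −cΔ_U + m²` (Ͱ-a `covLapF`), `c ≥ 0`, `m² > 0`, unitary `U, V`, any fibre `𝕜ⁿ`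
(`𝕜 = ℝ` or `ℂ`).  NOT Bałaban's (3.42); NOT a node discharge (N15 of record untouched); nothing continuum ∕ ℝ⁴ ∕ OS ∕ Clay.

THE POINT (door (t2⁵⁹) of the seat's HANDOFF §g53).  PART Ϭ-b∕Ϭ-d gave GLOBAL and LIPSCHITZ control of King's Gaussian normalisations ((2.13)–(2.14) p.653, (3.89)–(3.90) pp.668–669):
`|Δ ln det| ≤ N·(…)` with `N` the number of degrees of freedom, or `≤ N·(…)·‖U − V‖`.  A cluster expansion needs LOCALITY: a change of the background on a bond set `Z` must
cost `O(#Z)`, not `O(N)`.  The tree's `T4LogDetOscillation` (pub-balaban) has this SHAPE for real matrices with a Loewner floor `c·1` — constant `1∕c`, here `1∕m²` per unit of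
`Σ|ΔM_{ij}| ∼ c·#Z`, i.e. `O(c∕m²)·#Z`, which at King's scaling `c = L² = η⁻²` is NOT uniform in the spacing.  THIS FILE replaces the floor by KATO: the entries of the covariant
covariance `G_W = M_W⁻¹` are dominated by King's `A = 0` covariance at coinciding points, `‖G_W((x,i),(y,j))‖ ≤ G(x,x) = G(0,0)` (Ͱ-b `norm_inv_entry_le_diag`, Ε-e
`lapF_inv_diag_eq`), so the constant is `c·G(0,0)` — bounded uniformly in `η` AND in the volume in `d+1 ≥ 3` (PART Ϯ-e proves `c·G(0,0) ≤ 5∕4 + (m²L²M₀⁴)⁻¹` in `d+1 = 4`).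
THE MECHANISM.  (i) §1 the two-sided engine: Literature `ChordalSparsity.log_det_sub_log_det_le` at both ends gives `|ln det W′ − ln det W| ≤ B` as soon as
`|Re tr(W⁻¹(W′−W))|, |Re tr(W′⁻¹(W′−W))| ≤ B`; (ii) §2 the trace against a PLACED block: `tr(P·E_{xy}(A)) = Σ_{ij}P((y,j),(x,i))A_{ij}`, so `|Re tr(P·E_{xy}(A))| ≤ β·Σ_{ij}‖A_{ij}‖`
for `‖P_{··}‖ ≤ β`; (iii) §3 `M_U − M_V = T_V − T_U` is a sum over bonds of two placed blocks `c·(U(b) − V(b))`, `c·(U(b) − V(b))ᴴ`, whence ★★ `abs_re_trace_mul_covLapF_sub_le`: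
`|Re tr(P(M_U − M_V))| ≤ 2cβ·Σ_bΣ_{ij}‖U(b)_{ij} − V(b)_{ij}‖`; (iv) §4 `β = G(0,0)` by Kato ⟹ ★★★ **`abs_log_re_det_covLapF_sub_le_l1`**; (v) §5 if `U = V` off `Z` then the ℓ¹ distance is
`≤ 2|n|²·#Z` (unitary entries have norm `≤ 1`) ⟹ ★★★ **`abs_log_re_det_covLapF_sub_le_volume`** (`≤ 4c|n|²G(0,0)·#Z`) and the crude ★ `…_le_volume_mass` (`G(0,0) ≤ 1∕m²`, Ε-e).

PRIOR TREE ART (by name, not restated): Literature `ChordalSparsity.log_det_sub_log_det_le` [VandenbergheBoydWu1998 §3], `LatticeDiamagneticInequality` (`Hopping.hop`, `placed`),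
Ͱ-a `covLapF`∕`covLapF_eq`∕`kingHopping`∕`posDef_covLapF`, Ͱ-b `norm_inv_entry_le_diag`, Ε-e `lapF_inv_diag_eq`∕`lapF_inv_diag_le_inv_mass`, Ϯ-a (trace tools), Mathlib
`entry_norm_bound_of_unitary`; cited for the shape: `T4LogDetOscillation.abs_log_det_sub_log_det_le`.  Dedup (rg at filing): basename 0 files;
`trace_mul_placed|abs_re_trace_mul_placed_le|covLapF_sub_covLapF|abs_re_trace_mul_covLapF_sub_le|abs_log_re_det_sub_le_of_re_trace_le|abs_log_re_det_covLapF_sub_le_l1|abs_log_re_det_covLapF_sub_le_volume` 0 tree files.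
Locators: [King1986] (2.13)–(2.14) p.653, (3.89)–(3.90) pp.668–669, (4.4) p.670; [Balaban1985BackgroundPropagators] (3.23) p.394, (3.42) p.397; [VandenbergheBoydWu1998] §3 (3.2).  0 `sorry`, 0 `def`.
-/

noncomputable section

open scoped BigOperators ComplexConjugate ComplexOrder
open Finset Matrix

namespace Summit.QuantumFields.YangMills.BalabanUVNodes.N15KingModelRung.Analytic

open Literature.MathematicalPhysics.QuantumFieldTheory.LatticeDiamagneticInequality (Hopping placed)
open Literature.MathematicalPhysics.QuantumFieldTheory.Balaban1983to89.B5Prop11Plancherel (Tor unitVec)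
open Literature.MathematicalPhysics.QuantumFieldTheory.King1986.Torus (lapF)
open Literature.LinearAlgebra.Matrix.ChordalSparsity (log_det_sub_log_det_le)
open Summit.QuantumFields.YangMills.BalabanUVNodes.N15KingModelRung.Covariant (kingHopping covLapF covLapF_eq posDef_covLapF norm_inv_entry_le_diag lapF_inv_entry_nonneg)
open Summit.QuantumFields.YangMills.BalabanUVNodes.N15KingModelRung.TorusSpectral (lapF_inv_diag_eq lapF_inv_diag_le_inv_mass)

/-! ## §1 The two-sided response engine -/

section Engine

variable {𝕜 : Type*} [RCLike 𝕜] {ι : Type*} [Fintype ι] [DecidableEq ι]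

/-- `Re tr(W⁻¹(W′ − W)) = Re tr(W⁻¹W′) − N`. [cite: King1986, (3.94)–(3.96) p.669] -/
theorem re_trace_inv_mul_sub {W : Matrix ι ι 𝕜} (hW : IsUnit W) (W' : Matrix ι ι 𝕜) :
    RCLike.re (W⁻¹ * (W' - W)).trace = RCLike.re (W⁻¹ * W').trace - Fintype.card ι := by
  rw [Matrix.mul_sub, Matrix.nonsing_inv_mul _ ((Matrix.isUnit_iff_isUnit_det _).mp hW), Matrix.trace_sub, Matrix.trace_one, map_sub,
    RCLike.natCast_re]

/-- ★★ **THE TWO-SIDED RESPONSE ENGINE**: for positive definite `W, W′`, the concavity sandwich `Re tr(W′⁻¹(W′−W)) ≤ ln det W′ − ln det W ≤ Re tr(W⁻¹(W′−W))` (Literature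
`ChordalSparsity.log_det_sub_log_det_le` at both ends, = King's (3.96) at `n = 1`) turns bounds `|Re tr(W⁻¹(W′−W))|, |Re tr(W′⁻¹(W′−W))| ≤ B` into `|ln det W′ − ln det W| ≤ B`.
[cite: King1986, (3.94)–(3.96) p.669; VandenbergheBoydWu1998, §3 (3.2)] -/
theorem abs_log_re_det_sub_le_of_re_trace_le {W W' : Matrix ι ι 𝕜} (hW : W.PosDef) (hW' : W'.PosDef) {B : ℝ}
    (h1 : |RCLike.re (W⁻¹ * (W' - W)).trace| ≤ B) (h2 : |RCLike.re (W'⁻¹ * (W' - W)).trace| ≤ B) :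
    |Real.log (RCLike.re W'.det) - Real.log (RCLike.re W.det)| ≤ B := by
  have hup := (log_det_sub_log_det_le hW hW').1
  have hdn := (log_det_sub_log_det_le hW' hW).1
  rw [← re_trace_inv_mul_sub hW.isUnit] at hup
  rw [← re_trace_inv_mul_sub hW'.isUnit] at hdn
  have e : RCLike.re (W'⁻¹ * (W - W')).trace = -RCLike.re (W'⁻¹ * (W' - W)).trace := by
    rw [← map_neg, ← Matrix.trace_neg, ← Matrix.mul_neg, neg_sub]
  rw [e] at hdn
  rw [abs_sub_le_iff]
  constructor
  · exact hup.trans ((le_abs_self _).trans h1)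
  · exact hdn.trans ((neg_le_abs _).trans h2)

end Engine

/-! ## §2 Traces against placed blocks -/

section Placed

variable {𝕜 : Type*} [RCLike 𝕜] {ι : Type*} [Fintype ι] [DecidableEq ι] {n : Type*} [Fintype n]

/-- ★ `tr(P·E_{xy}(A)) = Σ_{ij} P((y,j),(x,i))·A_{ij}` for the block `A` placed at `(x,y)`. [cite: Balaban1985BackgroundPropagators, (3.23) p.394] -/
theorem trace_mul_placed (P : Matrix (ι × n) (ι × n) 𝕜) (x y : ι) (A : Matrix n n 𝕜) :
    (P * placed x y A).trace = ∑ i, ∑ j, P (y, j) (x, i) * A i j := by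
  rw [Matrix.trace]
  simp only [Matrix.diag_apply, Matrix.mul_apply, placed, Matrix.of_apply]
  rw [Fintype.sum_prod_type]
  simp_rw [Fintype.sum_prod_type (f := fun q : ι × n => P _ q * (if x = q.1 ∧ y = _ then A q.2 _ else 0))]
  rw [Finset.sum_comm]
  -- `∑ j, ∑ p1, ∑ q1, ∑ i, P (p1,j) (q1,i) * [x = q1 ∧ y = p1] A i j`
  have h : ∀ j : n, (∑ p1 : ι, ∑ q1 : ι, ∑ i : n, P (p1, j) (q1, i) * (if x = q1 ∧ y = p1 then A i j else 0)) = ∑ i, P (y, j) (x, i) * A i j := by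
    intro j
    rw [Finset.sum_eq_single y (fun p1 _ hp1 => ?_) (fun h => absurd (Finset.mem_univ _) h)]
    · rw [Finset.sum_eq_single x (fun q1 _ hq1 => ?_) (fun h => absurd (Finset.mem_univ _) h)]
      · simp
      · simp [Ne.symm hq1]
    · refine Finset.sum_eq_zero fun q1 _ => Finset.sum_eq_zero fun i _ => ?_
      simp [Ne.symm hp1]
  rw [Finset.sum_congr rfl fun j _ => h j, Finset.sum_comm]

/-- ★ `|Re tr(P·E_{xy}(A))| ≤ β·Σ_{ij}‖A_{ij}‖` when every entry of `P` has norm `≤ β`. [cite: King1986, (2.13) p.653; Balaban1985BackgroundPropagators, (3.23) p.394] -/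
theorem abs_re_trace_mul_placed_le {P : Matrix (ι × n) (ι × n) 𝕜} {β : ℝ} (hP : ∀ a b, ‖P a b‖ ≤ β) (x y : ι) (A : Matrix n n 𝕜) :
    |RCLike.re (P * placed x y A).trace| ≤ β * ∑ i, ∑ j, ‖A i j‖ := by
  rw [trace_mul_placed, map_sum]
  simp_rw [map_sum]
  calc |∑ i, ∑ j, RCLike.re (P (y, j) (x, i) * A i j)|
      ≤ ∑ i, ∑ j, |RCLike.re (P (y, j) (x, i) * A i j)| :=
        (Finset.abs_sum_le_sum_abs _ _).trans (Finset.sum_le_sum fun i _ => Finset.abs_sum_le_sum_abs _ _)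
    _ ≤ ∑ i, ∑ j, β * ‖A i j‖ := by
        refine Finset.sum_le_sum fun i _ => Finset.sum_le_sum fun j _ => ?_
        calc |RCLike.re (P (y, j) (x, i) * A i j)| ≤ ‖P (y, j) (x, i) * A i j‖ := RCLike.abs_re_le_norm _
          _ = ‖P (y, j) (x, i)‖ * ‖A i j‖ := norm_mul _ _
          _ ≤ β * ‖A i j‖ := mul_le_mul_of_nonneg_right (hP _ _) (norm_nonneg _)
    _ = β * ∑ i, ∑ j, ‖A i j‖ := by simp only [← Finset.mul_sum]

omit [Fintype ι] [DecidableEq ι] in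
/-- `Σ_{ij}‖(Aᴴ)_{ij}‖ = Σ_{ij}‖A_{ij}‖`. [folklore] -/
theorem sum_norm_conjTranspose_entry (A : Matrix n n 𝕜) : ∑ i, ∑ j, ‖Aᴴ i j‖ = ∑ i, ∑ j, ‖A i j‖ := by
  simp only [Matrix.conjTranspose_apply, norm_star]
  rw [Finset.sum_comm]

/-- `tr(P·E_{xy}(·))` is additive: `tr(P·E_{xy}(A)) − tr(P·E_{xy}(B)) = tr(P·E_{xy}(A − B))`. [folklore] -/
theorem trace_mul_placed_sub (P : Matrix (ι × n) (ι × n) 𝕜) (x y : ι) (A B : Matrix n n 𝕜) :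
    (P * placed x y A).trace - (P * placed x y B).trace = (P * placed x y (A - B)).trace := by
  rw [trace_mul_placed, trace_mul_placed, trace_mul_placed, ← Finset.sum_sub_distrib]
  refine Finset.sum_congr rfl fun i _ => ?_
  rw [← Finset.sum_sub_distrib]
  refine Finset.sum_congr rfl fun j _ => ?_
  rw [Matrix.sub_apply, mul_sub]

end Placed

/-! ## §3 The King datum: `M_U − M_V` is a sum over bonds of two placed blocks -/

section KingDatum

variable {d : ℕ} (K : Fin (d + 1) → ℕ) [hK : ∀ μ, NeZero (K μ)]
variable {𝕜 : Type*} [RCLike 𝕜] {n : Type*} [Fintype n] [DecidableEq n]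

omit [Fintype n] in
/-- `M_U − M_V = T_V − T_U` (the site weights cancel). [cite: Balaban1985BackgroundPropagators, (3.23) p.394; King1986, (4.4) p.670] -/
theorem covLapF_sub_covLapF (c m2 : ℝ) (U V : Tor K × Fin (d + 1) → Matrix n n 𝕜) :
    covLapF K c m2 U - covLapF K c m2 V = (kingHopping K c m2).hop V - (kingHopping K c m2).hop U := by
  rw [covLapF_eq, covLapF_eq, sub_sub_sub_cancel_left]

/-- ★ THE TRACE AGAINST THE HOPPING DIFFERENCE, BOND BY BOND: `tr(P(M_U − M_V)) = −c·Σ_b[tr(P·E_{x,x+e_μ}(U(b)−V(b))) + tr(P·E_{x+e_μ,x}((U(b)−V(b))ᴴ))]`, `b = (x,μ)`.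
[cite: Balaban1985BackgroundPropagators, (3.23) p.394; King1986, (4.4) p.670] -/
theorem trace_mul_covLapF_sub (P : Matrix (Tor K × n) (Tor K × n) 𝕜) (c m2 : ℝ) (U V : Tor K × Fin (d + 1) → Matrix n n 𝕜) :
    (P * (covLapF K c m2 U - covLapF K c m2 V)).trace
      = -((c : 𝕜) * ∑ b : Tor K × Fin (d + 1), ((P * placed b.1 (b.1 + unitVec K b.2) (U b - V b)).trace
            + (P * placed (b.1 + unitVec K b.2) b.1 (U b - V b)ᴴ).trace)) := by
  rw [covLapF_sub_covLapF]
  simp only [Hopping.hop, kingHopping]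
  rw [Matrix.mul_sub, Matrix.trace_sub, Matrix.mul_sum, Matrix.mul_sum, Matrix.trace_sum, Matrix.trace_sum, ← Finset.sum_sub_distrib,
    Finset.mul_sum, ← Finset.sum_neg_distrib]
  refine Finset.sum_congr rfl fun b _ => ?_
  rw [Matrix.mul_smul, Matrix.mul_smul, Matrix.trace_smul, Matrix.trace_smul, Matrix.mul_add, Matrix.mul_add, Matrix.trace_add, Matrix.trace_add,
    smul_eq_mul, smul_eq_mul, Matrix.conjTranspose_sub, ← trace_mul_placed_sub, ← trace_mul_placed_sub]
  ring

/-- ★★ **`|Re tr(P(M_U − M_V))| ≤ 2cβ·Σ_bΣ_{ij}‖U(b)_{ij} − V(b)_{ij}‖`** for `c ≥ 0` and `‖P_{··}‖ ≤ β`: each bond contributes two placed blocks of entries `c·(U−V)_{ij}`, `c·(U−V)ᴴ_{ij}`.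
[cite: King1986, (2.13) p.653, (4.4) p.670; Balaban1985BackgroundPropagators, (3.23) p.394] -/
theorem abs_re_trace_mul_covLapF_sub_le {P : Matrix (Tor K × n) (Tor K × n) 𝕜} {β : ℝ} (hP : ∀ a b, ‖P a b‖ ≤ β) {c : ℝ} (hc : 0 ≤ c) (m2 : ℝ)
    (U V : Tor K × Fin (d + 1) → Matrix n n 𝕜) :
    |RCLike.re (P * (covLapF K c m2 U - covLapF K c m2 V)).trace| ≤ 2 * c * β * ∑ b, ∑ i, ∑ j, ‖U b i j - V b i j‖ := by
  rw [trace_mul_covLapF_sub, map_neg, abs_neg, RCLike.re_ofReal_mul, abs_mul, abs_of_nonneg hc, map_sum]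
  have hterm : ∀ b : Tor K × Fin (d + 1),
      |RCLike.re ((P * placed b.1 (b.1 + unitVec K b.2) (U b - V b)).trace + (P * placed (b.1 + unitVec K b.2) b.1 (U b - V b)ᴴ).trace)|
        ≤ 2 * β * ∑ i, ∑ j, ‖U b i j - V b i j‖ := by
    intro b
    rw [map_add]
    refine (abs_add_le _ _).trans ?_
    have h1 := abs_re_trace_mul_placed_le hP b.1 (b.1 + unitVec K b.2) (U b - V b)
    have h2 := abs_re_trace_mul_placed_le hP (b.1 + unitVec K b.2) b.1 (U b - V b)ᴴ
    rw [sum_norm_conjTranspose_entry] at h2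
    simp only [Matrix.sub_apply] at h1 h2
    linarith
  calc c * |∑ b, RCLike.re ((P * placed b.1 (b.1 + unitVec K b.2) (U b - V b)).trace + (P * placed (b.1 + unitVec K b.2) b.1 (U b - V b)ᴴ).trace)|
      ≤ c * ∑ b, 2 * β * ∑ i, ∑ j, ‖U b i j - V b i j‖ :=
        mul_le_mul_of_nonneg_left ((Finset.abs_sum_le_sum_abs _ _).trans (Finset.sum_le_sum fun b _ => hterm b)) hc
    _ = 2 * c * β * ∑ b, ∑ i, ∑ j, ‖U b i j - V b i j‖ := by rw [← Finset.mul_sum]; ring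

end KingDatum

/-! ## §4 The volume law in ℓ¹ form: the constant is King's diagonal `G(0,0)` -/

section L1

variable {d : ℕ} (K : Fin (d + 1) → ℕ) [hK : ∀ μ, NeZero (K μ)]
variable {𝕜 : Type*} [RCLike 𝕜] {n : Type*} [Fintype n] [DecidableEq n]
variable {c m2 : ℝ} (hc : 0 ≤ c) (hm : 0 < m2)
variable {U V : Tor K × Fin (d + 1) → Matrix n n 𝕜} (hU : ∀ bd, U bd ∈ Matrix.unitaryGroup n 𝕜) (hV : ∀ bd, V bd ∈ Matrix.unitaryGroup n 𝕜)
include hc hm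

/-- KATO IN THE FORM NEEDED: every entry of the covariant covariance `G_W = M_W⁻¹` has norm `≤ G(0,0) = (lapF)⁻¹(0,0)` (Ͱ-b `norm_inv_entry_le_diag` + translation invariance of
King's diagonal, Ε-e `lapF_inv_diag_eq`). [cite: King1986, (4.4) p.670, (4.35) p.674; Balaban1985BackgroundPropagators, (3.42) p.397] -/
theorem norm_covLapF_inv_entry_le_diag_zero {W : Tor K × Fin (d + 1) → Matrix n n 𝕜} (hW : ∀ bd, W bd ∈ Matrix.unitaryGroup n 𝕜) (a b : Tor K × n) :
    ‖(covLapF K c m2 W)⁻¹ a b‖ ≤ (lapF K c m2)⁻¹ 0 0 := by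
  obtain ⟨x, i⟩ := a
  obtain ⟨y, j⟩ := b
  have h := norm_inv_entry_le_diag K hc hm hW x y i j
  rwa [lapF_inv_diag_eq K hc hm x, ← lapF_inv_diag_eq K hc hm 0] at h

include hU hV

/-- ★★★ **THE VOLUME LAW FOR THE FINE NORMALISATION, ℓ¹ FORM**: `|ln det M_U − ln det M_V| ≤ 2c·G(0,0)·Σ_bΣ_{ij}‖U(b)_{ij} − V(b)_{ij}‖` at every pair of unitary link fields —
the response sandwich at both ends (§1), the trace bond by bond (§3), and Kato's bound `G(0,0)` on the entries of BOTH covariant covariances `M_U⁻¹`, `M_V⁻¹`.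
[cite: King1986, (2.13)–(2.14) p.653, (3.89)–(3.90) pp.668–669, (4.4) p.670; Balaban1985BackgroundPropagators, (3.23) p.394, (3.42) p.397; VandenbergheBoydWu1998, §3 (3.2)] -/
theorem abs_log_re_det_covLapF_sub_le_l1 :
    |Real.log (RCLike.re (covLapF K c m2 U).det) - Real.log (RCLike.re (covLapF K c m2 V).det)|
      ≤ 2 * c * (lapF K c m2)⁻¹ 0 0 * ∑ b, ∑ i, ∑ j, ‖U b i j - V b i j‖ := by
  refine abs_log_re_det_sub_le_of_re_trace_le (posDef_covLapF K hc hm hV) (posDef_covLapF K hc hm hU) ?_ ?_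
  · exact abs_re_trace_mul_covLapF_sub_le K (norm_covLapF_inv_entry_le_diag_zero K hc hm hV) hc m2 U V
  · exact abs_re_trace_mul_covLapF_sub_le K (norm_covLapF_inv_entry_le_diag_zero K hc hm hU) hc m2 U V

end L1

/-! ## §5 The volume law: backgrounds that agree off a bond set `Z` -/

section Volume

variable {d : ℕ} (K : Fin (d + 1) → ℕ) [hK : ∀ μ, NeZero (K μ)]
variable {𝕜 : Type*} [RCLike 𝕜] {n : Type*} [Fintype n] [DecidableEq n]

/-- THE ℓ¹ DISTANCE OF TWO UNITARY FIELDS THAT AGREE OFF `Z` is `≤ 2|n|²·#Z` (unitary entries have norm `≤ 1`). [cite: King1986, (1.2)–(1.3) p.650] -/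
theorem sum_norm_link_sub_le_of_eqOn {U V : Tor K × Fin (d + 1) → Matrix n n 𝕜} (hU : ∀ bd, U bd ∈ Matrix.unitaryGroup n 𝕜) (hV : ∀ bd, V bd ∈ Matrix.unitaryGroup n 𝕜)
    {Z : Finset (Tor K × Fin (d + 1))} (hZ : ∀ bd, bd ∉ Z → U bd = V bd) :
    ∑ b, ∑ i, ∑ j, ‖U b i j - V b i j‖ ≤ 2 * (Fintype.card n : ℝ) ^ 2 * Z.card := by
  classical
  have hsplit : ∑ b, ∑ i, ∑ j, ‖U b i j - V b i j‖ = ∑ b ∈ Z, ∑ i, ∑ j, ‖U b i j - V b i j‖ := by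
    rw [← Finset.sum_subset (Finset.subset_univ Z)]
    intro b _ hb
    simp [hZ b hb]
  rw [hsplit]
  have hb : ∀ b ∈ Z, ∑ i, ∑ j, ‖U b i j - V b i j‖ ≤ 2 * (Fintype.card n : ℝ) ^ 2 := by
    intro b _
    calc ∑ i, ∑ j, ‖U b i j - V b i j‖ ≤ ∑ _i : n, ∑ _j : n, (2 : ℝ) := by
          refine Finset.sum_le_sum fun i _ => Finset.sum_le_sum fun j _ => (norm_sub_le _ _).trans ?_
          have h1 := entry_norm_bound_of_unitary (hU b) i j
          have h2 := entry_norm_bound_of_unitary (hV b) i j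
          linarith
      _ = 2 * (Fintype.card n : ℝ) ^ 2 := by simp [Finset.sum_const, Finset.card_univ]; ring
  calc ∑ b ∈ Z, ∑ i, ∑ j, ‖U b i j - V b i j‖ ≤ ∑ _b ∈ Z, 2 * (Fintype.card n : ℝ) ^ 2 := Finset.sum_le_sum hb
    _ = 2 * (Fintype.card n : ℝ) ^ 2 * Z.card := by rw [Finset.sum_const, nsmul_eq_mul]; ring

variable {c m2 : ℝ} (hc : 0 ≤ c) (hm : 0 < m2)
variable {U V : Tor K × Fin (d + 1) → Matrix n n 𝕜} (hU : ∀ bd, U bd ∈ Matrix.unitaryGroup n 𝕜) (hV : ∀ bd, V bd ∈ Matrix.unitaryGroup n 𝕜)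
include hc hm hU hV

/-- ★★★ **THE VOLUME LAW FOR THE FINE GAUSSIAN NORMALISATION**: if two unitary backgrounds agree off the bond set `Z`, then
`|ln det(−cΔ_U + m²) − ln det(−cΔ_V + m²)| ≤ 4c·|n|²·G(0,0)·#Z` — the cost of a local change of the background is proportional to the NUMBER OF CHANGED BONDS, with the constant
`c·G(0,0)` (King's `A = 0` covariance at coinciding points in units of the hopping), NOT to the number of degrees of freedom. [cite: King1986, (2.13)–(2.14) p.653, (3.89)–(3.90) pp.668–669,
(4.4) p.670; Balaban1985BackgroundPropagators, (3.23) p.394, (3.42) p.397] -/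
theorem abs_log_re_det_covLapF_sub_le_volume {Z : Finset (Tor K × Fin (d + 1))} (hZ : ∀ bd, bd ∉ Z → U bd = V bd) :
    |Real.log (RCLike.re (covLapF K c m2 U).det) - Real.log (RCLike.re (covLapF K c m2 V).det)|
      ≤ 4 * c * (Fintype.card n : ℝ) ^ 2 * (lapF K c m2)⁻¹ 0 0 * Z.card := by
  have hG : 0 ≤ (lapF K c m2)⁻¹ (0 : Tor K) 0 := lapF_inv_entry_nonneg K hc hm 0 0
  calc |Real.log (RCLike.re (covLapF K c m2 U).det) - Real.log (RCLike.re (covLapF K c m2 V).det)|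
      ≤ 2 * c * (lapF K c m2)⁻¹ 0 0 * ∑ b, ∑ i, ∑ j, ‖U b i j - V b i j‖ := abs_log_re_det_covLapF_sub_le_l1 K hc hm hU hV
    _ ≤ 2 * c * (lapF K c m2)⁻¹ 0 0 * (2 * (Fintype.card n : ℝ) ^ 2 * Z.card) :=
        mul_le_mul_of_nonneg_left (sum_norm_link_sub_le_of_eqOn K hU hV hZ) (by positivity)
    _ = 4 * c * (Fintype.card n : ℝ) ^ 2 * (lapF K c m2)⁻¹ 0 0 * Z.card := by ring

/-- ★ THE CRUDE (LOEWNER-FLOOR) FORM: `G(0,0) ≤ 1∕m²` (Ε-e `lapF_inv_diag_le_inv_mass`) gives `≤ 4c|n|²·#Z∕m²` — the constant of the `T4LogDetOscillation` route, `O(c∕m²)`, NOT uniform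
in the spacing at King's scaling `c = L²`; PART Ϯ-e sharpens `c·G(0,0)` to `5∕4 + (m²L²M₀⁴)⁻¹` in `d+1 = 4`. [cite: King1986, (2.13) p.653, (4.4) p.670] -/
theorem abs_log_re_det_covLapF_sub_le_volume_mass {Z : Finset (Tor K × Fin (d + 1))} (hZ : ∀ bd, bd ∉ Z → U bd = V bd) :
    |Real.log (RCLike.re (covLapF K c m2 U).det) - Real.log (RCLike.re (covLapF K c m2 V).det)|
      ≤ 4 * c * (Fintype.card n : ℝ) ^ 2 * m2⁻¹ * Z.card :=
  (abs_log_re_det_covLapF_sub_le_volume K hc hm hU hV hZ).trans (by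
    have := lapF_inv_diag_le_inv_mass K hc hm (0 : Tor K)
    gcongr)

end Volume

end Summit.QuantumFields.YangMills.BalabanUVNodes.N15KingModelRung.Analytic

end
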